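import Summits.MatrixMultiplication.MatrixMultiplication.Theorems.GraphEquationsExponentDescentPrelims
import Summits.MatrixMultiplication.MatrixMultiplication.Theorems.GraphEquationsTestCount
import Summits.MatrixMultiplication.MatrixMultiplication.Theorems.GraphEquationsCorankUnmasking

/-!
# GraphEquations — definitions for exponent descent (THEOREM ED, part 0/4: definitions only)

Decomp-mm node «GraphEquations» (lens 5); attacked crux `MultiplicityReduction` (route
GraphEquations, item stmt-MatrixMultiplication-27806), registered line
`Cruxes/MultiplicityReduction/Lines/birth.lean` («exponent ladder»).  Part of THEOREM ED
(`Theorems/GraphEquationsExponentDescent.lean` proves its middle stub `stub_exponentDescent` by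
statement); paper lens-5 g94, Lean text g95–g101, first elaborated g122.

* `EqSystem.corank E x`  — the corank `n² − rank J_C(E)(x)` of the `C`-Jacobian at `x`;
* `fibreJet x`           — the fibre jet `Φ_x : ℂ[A,B,C] → ℂ[u]`, `A,B ↦ A(x),B(x)`,
                           `c_q ↦ u_q + c_q(x)`;
* `genProd`, `prodVal`, `genSum`, `genCellGates`, `partialGen`, `EqSystem.genCell`,
  `EqSystem.nilSystem`, `EqSystem.genSystem` — the generator cell (`f_q = c_q − Σ_k a_(q₁k) b_(kq₂)`
  in `2n` fan-in-two gates) and the generator system of a list of coordinates.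
The lemmas about them are in `…FibreJet`, `…JetCount`, `…GeneratorSurgery`, `…ExponentDescent`.
-/

set_option linter.dupNamespace false

namespace Summit.MatrixMultiplication.MatrixMultiplication.Theorems.GraphEquations

open MvPolynomial
-- `Basis` below is `Module.Basis` (tree precedent `open Matrix Module`,
-- GraphEquationsCorankUnmasking l.49).
open Module
open Literature.Computability.AlgebraicComplexity
open Literature.Computability.AlgebraicComplexity.ArithCircuit
open Literature.AlgebraicGeometry.Hironaka2017.EdgeAlgebra (isHomogeneous_aeval_linear
  homogeneousComponent_aeval_linear)
open Literature.AlgebraicGeometry.Resolution (homogeneousComponent_eq_zero_of_mem_pow_idealOfVars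
  mem_pow_idealOfVars_of_isHomogeneous sub_sum_homogeneousComponent_mem_pow_idealOfVars)

variable {n : ℕ}

namespace EqSystem

/-- The CORANK `s = n² − rank J_C(E)(x)` of the `C`-Jacobian at `x` (`ReducedAt x ⟺ corank = 0`). -/
noncomputable def corank (E : EqSystem n) (x : GraphVars n → ℂ) : ℕ :=
  n * n - (E.jacobianC x).rank

end EqSystem

/-- The FIBRE JET at `x`: restriction to the affine `n²`-plane `{(A(x), B(x), C)}` through `x`,
in the coordinates `u = C − C(x)`. -/
noncomputable def fibreJet (x : GraphVars n → ℂ) :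
    MvPolynomial (GraphVars n) ℂ →ₐ[ℂ] MvPolynomial (Fin n × Fin n) ℂ :=
  MvPolynomial.aeval (Sum.elim (fun v : MatMulVars n => C (x (Sum.inl v)))
    (fun q : Fin n × Fin n => X q + C (x (Sum.inr q))))

/-- The `k`-th product gate of the cell of `q`: `a_{q₁ k} · b_{k q₂}` (junk empty product for
`k ≥ n`, never used). -/
def genProd (q : Fin n × Fin n) (k : ℕ) : Gate ℂ (GraphVars n) :=
  if h : k < n then
    .prod [.var (Sum.inl (Sum.inl (q.1, ⟨k, h⟩))), .var (Sum.inl (Sum.inr (⟨k, h⟩, q.2)))]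
  else .prod []

/-- Its value (independent of the earlier gates). -/
noncomputable def prodVal (q : Fin n × Fin n) (k : ℕ) : MvPolynomial (GraphVars n) ℂ :=
  if h : k < n then X (Sum.inl (Sum.inl (q.1, ⟨k, h⟩))) * X (Sum.inl (Sum.inr (⟨k, h⟩, q.2))) else 1

/-- The `k`-th partial-sum gate: `σ₀ = c_q − p₀` reads gate `0` (it is `testGate q 0`,
Generators l.78); `σ_{k+1} = σ_k − p_{k+1}` reads gates `2k+1` (`σ_k`) and `2k+2` (`p_{k+1}`). -/
def genSum (q : Fin n × Fin n) : ℕ → Gate ℂ (GraphVars n)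
  | 0 => testGate q 0
  | k + 1 => .sum [(1, .gate (2 * k + 1)), (-1, .gate (2 * k + 2))]

/-- The interleaved gate list after `k` rounds: `p₀, σ₀, p₁, σ₁, …, p_{k−1}, σ_{k−1}`. -/
def genCellGates (q : Fin n × Fin n) : ℕ → List (Gate ℂ (GraphVars n))
  | 0 => []
  | k + 1 => genCellGates q k ++ [genProd q k] ++ [genSum q k]

/-- The partial generator `c_q − Σ_{i ≤ k} a_{q₁ i} b_{i q₂}` (junk terms `1` beyond `n`, unused). -/
noncomputable def partialGen (q : Fin n × Fin n) (k : ℕ) : MvPolynomial (GraphVars n) ℂ :=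
  X (Sum.inr q) - ∑ i ∈ Finset.range (k + 1), prodVal q i

namespace EqSystem

/-- The CELL of `q`: `2n` gates, one test (the last gate, index `2n − 1`). -/
noncomputable def genCell (q : Fin n × Fin n) : EqSystem n :=
  ⟨⟨genCellGates q n, .const 0⟩, [2 * n - 1]⟩

/-- The empty system. -/
def nilSystem : EqSystem n := ⟨⟨[], .const 0⟩, []⟩

/-- The cells of `qs`, juxtaposed (`juxt`, RowCriterion l.159). -/
noncomputable def genSystem : List (Fin n × Fin n) → EqSystem n
  | [] => nilSystem
  | q :: qs => (genCell q).juxt (genSystem qs)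

end EqSystem

end Summit.MatrixMultiplication.MatrixMultiplication.Theorems.GraphEquations
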